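import Literature.MathematicalPhysics.QuantumFieldTheory.Balaban1983to89.B1Eq324BenfattoSect5ErrTermAbsorb
import Literature.MathematicalPhysics.QuantumFieldTheory.Balaban1983to89.B1Eq324BenfattoSect5Eq511
import HarnessLib

/-!
# `Balaban1983to89.B1Eq324BenfattoSect5ErrTermLedger` — [BenfattoEtAl1978] p. 152 (4.6)–(4.7) and p. 159 «Collecting all the errors made in this process»:
# THE LEDGER TOOLKIT — how each SHAPE of per-step error fits `|I|·errTerm S ρ₁ ρ₂ ρ₃ ρ₄ A b t`, and print's parameter choice
# (tesserae of side `L = ⌈b²⌉`, corridors `v = ⌈M b^{3/2}⌉`, `w = 2v`, `b > b*`) — PROVED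

statement-level skeleton of published theorems with citation tags; proofs where landed; nothing here is a claim about the
Yang–Mills mass gap

WHY THIS MODULE (cell `pub-ymgap`, seat `dag-n08-c` gen 19, INTENT-4; node N08 [Balaban1985UV3]; obligation (O2)/(O2′) of `…Sect5CollectErrors.ineq47_of_chain`
/ `…Sect5PavementChainUpper.ineq46_of_chain`).  `errTerm S ρ₁ ρ₂ ρ₃ ρ₄ A b t = S·((A·b^{ρ₁}·e^{ρ₂Ab^{ρ₃}})^{t+1} + e^{−ρ₃b^{3/2}}·e^{ρ₄Ab^{ρ₃}})`
(`B1Eq324BenfattoLemma.errTerm`).  The losses of one pavement step come in four shapes: (i) the `(t+1)`-st order remainder `C·(A·b^{D}·L^{d})^{t+1}`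
((5.21)/(5.33)); (ii) `C·b^q·A^j·e^{−c·X}` with `X` a corridor width `≥ M·b^{3/2}` ((5.11), (5.34), Appendix D across `Γ₄`, (5.31) as `θ^{w−v}`);
(iii) `C·b^q·e^{c₂Ab^{p}}·e^{−(γ′b)²/4}` (the small-field volume `e^{2K}·3|□|e^{−b²/4}` of (5.19)/(5.20), at the cut-offs `γ^k b`); (iv) Appendix A's
`|I|·k₁e^{−k₂c²}`.  This file maps each shape into one of the two summands of `errTerm` with an explicit `S`, shows `errTerm` is additive and monotone
in `S` (so a finite ledger sums), and records the elementary facts of print's parameter choice (`L = ⌈b²⌉`, `v = ⌈Mb^{3/2}⌉`, `w = 2v`: the displaced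
pavements fit, thresholds are `≥ 1`, the corridor widths dominate `M b^{3/2}`).

WHAT IS PROVED (theorems only; no definition, no named fact, no `sorry`; axioms standard).
* §1 `errTerm_add`, `errTerm_nonneg`, `errTerm_mono`, `le_errTerm_of_le_fst`, `le_errTerm_of_le_snd`, `sum_le_errTerm_sum` (the ledger sums).
* §2 into the second summand: ★ `poly_mul_exp_neg_le_snd` (shape (ii)), ★ `poly_mul_pow_le_snd` (shape (ii) with `θ^n`, `0 < θ < 1`),
  ★ `poly_mul_gauss_le_snd` (shape (iii)), `appendixA_term_le_snd` (shape (iv)).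
* §3 into the first summand: `remainder_le_fst` (shape (i)).
* §4 print's parameters: `sq_le_natCeil_sq`, `natCeil_sq_le_two_mul_sq` (`b² ≤ L = ⌈b²⌉ ≤ 2b²`), ★ `shifts_fit` (`10(d+1)⌈Mb^{3/2}⌉ ≤ ⌈b²⌉`
  for `b ≥ (10(d+1)(M+1))²`), `one_le_pow_mul_of_le` (`1 ≤ γ^k b` for `b ≥ γ^{−n}`, `k ≤ n`).
* §5 uniformity in `s` (the Lemma's constants are quantified BEFORE `s`): `admissible_eq_empty_of_lt` (no admissible exponents in degree `p > D`),
  ★ `sum_card_admissible_mul_le` (`Σ_{p≤s}#adm(p,D)·f(p) ≤ Σ_{p≤D}#adm(p,D)·f(p)`, `f ≥ 0`), `decayConst_nonneg`, ★ `s1Const_le` (`s₁(s) ≤ s₁(D)`), `s1Const_nonneg`.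

HONEST SCOPE / NOT HERE.  Elementary real analysis and bookkeeping; WHICH losses occur (the list (i)–(iv) with their constants) is the assembly's
(`…CollectErrors` (O2), the per-box `Err` of `…PerBoxAppD`, the identification losses of `…FreeStep*`/`…FreePerturb`/`…HlCumulants`); `b*` is the max
of the thresholds used.  `BasicLemmaPrinted` stays OPEN; count-neutral for N08; nothing of [Balaban1985UV3] (41)/(47)/(5) is asserted; nothing about
d = 4, the continuum, OS axioms, a mass gap or the Clay problem.
-/

noncomputable section

open Finset
open scoped BigOperators

namespace Literature.MathematicalPhysics.QuantumFieldTheory.Balaban1983to89.B1Eq324BenfattoSect5ErrTermLedger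

open Literature.MathematicalPhysics.QuantumFieldTheory.Balaban1983to89.B1Eq324BenfattoLemma
open Literature.MathematicalPhysics.QuantumFieldTheory.Balaban1983to89.B1Eq324BenfattoSect5ErrTermAbsorb
open Literature.MathematicalPhysics.QuantumFieldTheory.Balaban1983to89.B1Eq324BenfattoSect5Eq511 (decayConst s1Const)

/-! ## §1  `errTerm` is additive and monotone in `S`: a finite ledger sums -/

section Algebra

variable {S S₁ S₂ ρ₁ ρ₂ ρ₃ ρ₄ A b : ℝ} {t : ℕ}

/-- `errTerm` is linear in `S`. [cite: BenfattoEtAl1978, (4.6)–(4.7) p.152] -/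
theorem errTerm_add (S₁ S₂ ρ₁ ρ₂ ρ₃ ρ₄ A b : ℝ) (t : ℕ) :
    errTerm (S₁ + S₂) ρ₁ ρ₂ ρ₃ ρ₄ A b t = errTerm S₁ ρ₁ ρ₂ ρ₃ ρ₄ A b t + errTerm S₂ ρ₁ ρ₂ ρ₃ ρ₄ A b t := by
  unfold errTerm
  ring

/-- The bracket `(A b^{ρ₁} e^{ρ₂Ab^{ρ₃}})^{t+1} + e^{−ρ₃b^{3/2}} e^{ρ₄Ab^{ρ₃}}` is non-negative (`A, b ≥ 0`). [cite: BenfattoEtAl1978, (4.6)–(4.7) p.152] -/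
theorem bracket_nonneg (hA : 0 ≤ A) (hb : 0 ≤ b) (ρ₁ ρ₂ ρ₃ ρ₄ : ℝ) (t : ℕ) :
    0 ≤ (A * b ^ ρ₁ * Real.exp (ρ₂ * A * b ^ ρ₃)) ^ (t + 1) + Real.exp (-(ρ₃ * b ^ (3 / 2 : ℝ))) * Real.exp (ρ₄ * A * b ^ ρ₃) :=
  add_nonneg (pow_nonneg (mul_nonneg (mul_nonneg hA (Real.rpow_nonneg hb _)) (Real.exp_pos _).le) _)
    (mul_nonneg (Real.exp_pos _).le (Real.exp_pos _).le)

/-- `errTerm S … ≥ 0` for `S, A, b ≥ 0`. [cite: BenfattoEtAl1978, (4.6)–(4.7) p.152] -/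
theorem errTerm_nonneg (hS : 0 ≤ S) (hA : 0 ≤ A) (hb : 0 ≤ b) : 0 ≤ errTerm S ρ₁ ρ₂ ρ₃ ρ₄ A b t := by
  unfold errTerm
  exact mul_nonneg hS (bracket_nonneg hA hb ρ₁ ρ₂ ρ₃ ρ₄ t)

/-- `errTerm` is monotone in `S` (`A, b ≥ 0`). [cite: BenfattoEtAl1978, (4.6)–(4.7) p.152] -/
theorem errTerm_mono (h : S₁ ≤ S₂) (hA : 0 ≤ A) (hb : 0 ≤ b) : errTerm S₁ ρ₁ ρ₂ ρ₃ ρ₄ A b t ≤ errTerm S₂ ρ₁ ρ₂ ρ₃ ρ₄ A b t := by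
  unfold errTerm
  exact mul_le_mul_of_nonneg_right h (bracket_nonneg hA hb ρ₁ ρ₂ ρ₃ ρ₄ t)

/-- **Into the ledger through the first summand**: `x ≤ S·(A b^{ρ₁} e^{ρ₂Ab^{ρ₃}})^{t+1}` ⇒ `x ≤ errTerm S …` (`S, A, b ≥ 0`).
[cite: BenfattoEtAl1978, (4.6)–(4.7) p.152] -/
theorem le_errTerm_of_le_fst {x : ℝ} (hx : x ≤ S * (A * b ^ ρ₁ * Real.exp (ρ₂ * A * b ^ ρ₃)) ^ (t + 1)) (hS : 0 ≤ S) :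
    x ≤ errTerm S ρ₁ ρ₂ ρ₃ ρ₄ A b t := by
  unfold errTerm
  rw [mul_add]
  exact hx.trans (le_add_of_nonneg_right (mul_nonneg hS (mul_nonneg (Real.exp_pos _).le (Real.exp_pos _).le)))

/-- **Into the ledger through the second summand**: `x ≤ S·e^{−ρ₃b^{3/2}}·e^{ρ₄Ab^{ρ₃}}` ⇒ `x ≤ errTerm S …` (`S, A, b ≥ 0`).
[cite: BenfattoEtAl1978, (4.6)–(4.7) p.152] -/
theorem le_errTerm_of_le_snd {x : ℝ} (hx : x ≤ S * (Real.exp (-(ρ₃ * b ^ (3 / 2 : ℝ))) * Real.exp (ρ₄ * A * b ^ ρ₃))) (hS : 0 ≤ S)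
    (hA : 0 ≤ A) (hb : 0 ≤ b) : x ≤ errTerm S ρ₁ ρ₂ ρ₃ ρ₄ A b t := by
  unfold errTerm
  rw [mul_add]
  exact hx.trans (le_add_of_nonneg_left (mul_nonneg hS (pow_nonneg (mul_nonneg (mul_nonneg hA (Real.rpow_nonneg hb _)) (Real.exp_pos _).le) _)))

/-- **A finite ledger sums**: if every loss `x_i` fits `errTerm S_i …`, the total fits `errTerm (Σ_i S_i) …`. [cite: BenfattoEtAl1978, §5 p.159] -/
theorem sum_le_errTerm_sum {ι : Type*} (s : Finset ι) (x Ss : ι → ℝ) (h : ∀ i ∈ s, x i ≤ errTerm (Ss i) ρ₁ ρ₂ ρ₃ ρ₄ A b t) :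
    ∑ i ∈ s, x i ≤ errTerm (∑ i ∈ s, Ss i) ρ₁ ρ₂ ρ₃ ρ₄ A b t := by
  have hlin : errTerm (∑ i ∈ s, Ss i) ρ₁ ρ₂ ρ₃ ρ₄ A b t = ∑ i ∈ s, errTerm (Ss i) ρ₁ ρ₂ ρ₃ ρ₄ A b t := by
    unfold errTerm
    rw [Finset.sum_mul]
  rw [hlin]
  exact Finset.sum_le_sum h

end Algebra

/-! ## §2  Shapes (ii)–(iv) fit the second summand `e^{−ρ₃b^{3/2}}·e^{ρ₄Ab^{ρ₃}}` -/

section Second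

variable {A b ρ₃ ρ₄ : ℝ}

/-- kernel: `A^j ≤ j!·e^{ρ₄Ab^{ρ₃}}` for `A ≥ 0`, `b ≥ 1`, `ρ₃ ≥ 0`, `ρ₄ ≥ 1` (`A^j/j! ≤ e^{A} ≤ e^{ρ₄Ab^{ρ₃}}`). [folklore] -/
private theorem pow_le_factorial_mul_exp (hA : 0 ≤ A) (hb : 1 ≤ b) (hρ₃ : 0 ≤ ρ₃) (hρ₄ : 1 ≤ ρ₄) (j : ℕ) :
    A ^ j ≤ (j.factorial : ℝ) * Real.exp (ρ₄ * A * b ^ ρ₃) := by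
  have h1 : A ^ j / (j.factorial : ℝ) ≤ Real.exp A := Real.pow_div_factorial_le_exp A hA j
  have hj : (0 : ℝ) < j.factorial := by exact_mod_cast Nat.factorial_pos j
  have h2 : A ^ j ≤ (j.factorial : ℝ) * Real.exp A := by
    rw [div_le_iff₀ hj] at h1
    linarith
  refine h2.trans (mul_le_mul_of_nonneg_left (Real.exp_le_exp.mpr ?_) hj.le)
  have hb1 : 1 ≤ b ^ ρ₃ := Real.one_le_rpow hb hρ₃
  have : A * 1 ≤ ρ₄ * A * b ^ ρ₃ := by
    have h' : A * 1 ≤ A * b ^ ρ₃ := mul_le_mul_of_nonneg_left hb1 hA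
    have h'' : A * b ^ ρ₃ ≤ ρ₄ * (A * b ^ ρ₃) := le_mul_of_one_le_left (mul_nonneg hA (zero_le_one.trans hb1)) hρ₄
    linarith [mul_assoc ρ₄ A (b ^ ρ₃)]
  linarith

/-- kernel: `b^q ≤ q!·e^{b^{3/2}}` for `b ≥ 1` (`…ErrTermAbsorb.pow_le_factorial_mul_exp_rpow` at `ε = 1`). [folklore] -/
private theorem pow_le_factorial_mul_exp_rpow_one (hb : 1 ≤ b) (q : ℕ) :
    b ^ q ≤ (q.factorial : ℝ) * Real.exp (b ^ (3 / 2 : ℝ)) := by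
  have h := pow_le_factorial_mul_exp_rpow hb one_pos q
  simpa using h

/-- **SHAPE (ii): `C·b^q·A^j·e^{−cX}` with a corridor width `X ≥ M·b^{3/2}`** — if `c ≥ 0`, `cM ≥ ρ₃ + 1`, `ρ₃ ≥ 0`, `ρ₄ ≥ 1`, `b ≥ 1`, `A ≥ 0`, `C ≥ 0`:
`C·b^q·A^j·e^{−cX} ≤ (C·q!·j!)·e^{−ρ₃b^{3/2}}·e^{ρ₄Ab^{ρ₃}}` (the unit of slack in `cM ≥ ρ₃ + 1` absorbs `b^q`).  This is how (5.11)/(5.34)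
(`X = w` or `v`, rate `ϰ/4`), the Appendix-D decay across `Γ₄` (`X = v + 1`, rate `δ/2`) and every polynomially weighted `e^{−cw}` loss enter the ledger.
[cite: BenfattoEtAl1978, (5.11) p.155, (5.29) p.157, (5.34) p.159, (4.7) p.152] -/
theorem poly_mul_exp_neg_le_snd {C c X M : ℝ} (hC : 0 ≤ C) (hA : 0 ≤ A) (hb : 1 ≤ b) (hρ₃ : 0 ≤ ρ₃) (hρ₄ : 1 ≤ ρ₄) (hc : 0 ≤ c)
    (hX : M * b ^ (3 / 2 : ℝ) ≤ X) (hM : ρ₃ + 1 ≤ c * M) (q j : ℕ) :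
    C * b ^ q * A ^ j * Real.exp (-(c * X)) ≤
      (C * q.factorial * j.factorial) * (Real.exp (-(ρ₃ * b ^ (3 / 2 : ℝ))) * Real.exp (ρ₄ * A * b ^ ρ₃)) := by
  have hb0 : 0 ≤ b := zero_le_one.trans hb
  have hB : 0 ≤ b ^ (3 / 2 : ℝ) := Real.rpow_nonneg hb0 _
  have h1 : b ^ q ≤ (q.factorial : ℝ) * Real.exp (b ^ (3 / 2 : ℝ)) := pow_le_factorial_mul_exp_rpow_one hb q
  have h2 : A ^ j ≤ (j.factorial : ℝ) * Real.exp (ρ₄ * A * b ^ ρ₃) := pow_le_factorial_mul_exp hA hb hρ₃ hρ₄ j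
  have h3 : Real.exp (-(c * X)) ≤ Real.exp (-((ρ₃ + 1) * b ^ (3 / 2 : ℝ))) := by
    rw [Real.exp_le_exp]
    have : (ρ₃ + 1) * b ^ (3 / 2 : ℝ) ≤ c * X := by
      calc (ρ₃ + 1) * b ^ (3 / 2 : ℝ) ≤ c * M * b ^ (3 / 2 : ℝ) := mul_le_mul_of_nonneg_right hM hB
        _ = c * (M * b ^ (3 / 2 : ℝ)) := by ring
        _ ≤ c * X := mul_le_mul_of_nonneg_left hX hc
    linarith
  have hkey : Real.exp (b ^ (3 / 2 : ℝ)) * Real.exp (-((ρ₃ + 1) * b ^ (3 / 2 : ℝ))) = Real.exp (-(ρ₃ * b ^ (3 / 2 : ℝ))) := by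
    rw [← Real.exp_add]
    congr 1
    ring
  calc C * b ^ q * A ^ j * Real.exp (-(c * X))
      ≤ C * ((q.factorial : ℝ) * Real.exp (b ^ (3 / 2 : ℝ))) * ((j.factorial : ℝ) * Real.exp (ρ₄ * A * b ^ ρ₃)) *
          Real.exp (-((ρ₃ + 1) * b ^ (3 / 2 : ℝ))) := by
        gcongr
  _ = (C * q.factorial * j.factorial) * ((Real.exp (b ^ (3 / 2 : ℝ)) * Real.exp (-((ρ₃ + 1) * b ^ (3 / 2 : ℝ)))) *
          Real.exp (ρ₄ * A * b ^ ρ₃)) := by ring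
  _ = _ := by rw [hkey]

/-- **SHAPE (ii′): `C·b^q·A^j·θⁿ` with `0 < θ < 1` and `n ≥ M·b^{3/2}`** (the (5.31) «(error)» at depth `w − v`, `θ = 2d/(2d+α²)`): if `(−log θ)·M ≥ ρ₃ + 1`,
`ρ₃ ≥ 0`, `ρ₄ ≥ 1`, `b ≥ 1`, `A, C ≥ 0`, then `C·b^q·A^j·θⁿ ≤ (C·q!·j!)·e^{−ρ₃b^{3/2}}·e^{ρ₄Ab^{ρ₃}}`.
[cite: BenfattoEtAl1978, (5.31) p.158, (C.8) p.165, (4.7) p.152] -/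
theorem poly_mul_pow_le_snd {C θ M : ℝ} {n : ℕ} (hC : 0 ≤ C) (hA : 0 ≤ A) (hb : 1 ≤ b) (hρ₃ : 0 ≤ ρ₃) (hρ₄ : 1 ≤ ρ₄) (hθ0 : 0 < θ)
    (hθ1 : θ < 1) (hn : M * b ^ (3 / 2 : ℝ) ≤ n) (hM : ρ₃ + 1 ≤ -Real.log θ * M) (q j : ℕ) :
    C * b ^ q * A ^ j * θ ^ n ≤ (C * q.factorial * j.factorial) * (Real.exp (-(ρ₃ * b ^ (3 / 2 : ℝ))) * Real.exp (ρ₄ * A * b ^ ρ₃)) := by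
  have hθn : θ ^ n = Real.exp (-(-Real.log θ * n)) := by
    rw [neg_mul, neg_neg, mul_comm, ← Real.log_pow, Real.exp_log (pow_pos hθ0 n)]
  rw [hθn]
  have hc : 0 ≤ -Real.log θ := by
    have := Real.log_neg hθ0 hθ1
    linarith
  exact poly_mul_exp_neg_le_snd hC hA hb hρ₃ hρ₄ hc hn hM q j

/-- **SHAPE (iii): the small-field volume loss `C·b^q·e^{c₂Ab^{p}}·e^{−(γ′b)²/4}`** ((5.19)/(5.20): `e^{2K}·3|□|e^{−b_k²/4}` at the cut-off `b_k = γ^k b ≥ γ′b`):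
if `0 < γ′`, `b ≥ 1`, `A, C ≥ 0`, `0 ≤ c₂ ≤ ρ₄`, `p ≤ ρ₃` (`ρ₃ ≥ 0`), then with `ρ := (ρ₃ + 1)/γ′^{3/2}`,
`C·b^q·e^{c₂Ab^{p}}·e^{−(γ′b)²/4} ≤ (C·q!·e^{27ρ⁴/4})·e^{−ρ₃b^{3/2}}·e^{ρ₄Ab^{ρ₃}}` (`…ErrTermAbsorb.exp_neg_sq_div_four_le_exp_neg_rpow`).
[cite: BenfattoEtAl1978, (5.19)–(5.20) p.156, Appendix A (A.2) p.161, (4.7) p.152] -/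
theorem poly_mul_gauss_le_snd {C c₂ p γ' : ℝ} (hC : 0 ≤ C) (hA : 0 ≤ A) (hb : 1 ≤ b) (hρ₃ : 0 ≤ ρ₃) (hγ' : 0 < γ')
    (hc₂ : 0 ≤ c₂) (hc₂' : c₂ ≤ ρ₄) (hp' : p ≤ ρ₃) (q : ℕ) :
    C * b ^ q * Real.exp (c₂ * A * b ^ p) * Real.exp (-((γ' * b) ^ 2 / 4)) ≤
      (C * q.factorial * Real.exp (27 / 4 * ((ρ₃ + 1) / γ' ^ (3 / 2 : ℝ)) ^ 4)) *
        (Real.exp (-(ρ₃ * b ^ (3 / 2 : ℝ))) * Real.exp (ρ₄ * A * b ^ ρ₃)) := by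
  have hb0 : 0 ≤ b := zero_le_one.trans hb
  have hB : 0 ≤ b ^ (3 / 2 : ℝ) := Real.rpow_nonneg hb0 _
  set ρ : ℝ := (ρ₃ + 1) / γ' ^ (3 / 2 : ℝ) with hρ
  have hg32 : 0 < γ' ^ (3 / 2 : ℝ) := Real.rpow_pos_of_pos hγ' _
  -- the Gaussian tail at `γ′b`
  have h1 : Real.exp (-((γ' * b) ^ 2 / 4)) ≤ Real.exp (27 / 4 * ρ ^ 4) * Real.exp (-(ρ * (γ' * b) ^ (3 / 2 : ℝ))) :=
    exp_neg_sq_div_four_le_exp_neg_rpow (mul_nonneg hγ'.le hb0) ρ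
  have h1' : ρ * (γ' * b) ^ (3 / 2 : ℝ) = (ρ₃ + 1) * b ^ (3 / 2 : ℝ) := by
    rw [Real.mul_rpow hγ'.le hb0, hρ]
    field_simp
  rw [h1'] at h1
  -- the polynomial and the `A`-exponential
  have h2 : b ^ q ≤ (q.factorial : ℝ) * Real.exp (b ^ (3 / 2 : ℝ)) := pow_le_factorial_mul_exp_rpow_one hb q
  have h3 : Real.exp (c₂ * A * b ^ p) ≤ Real.exp (ρ₄ * A * b ^ ρ₃) := by
    rw [Real.exp_le_exp]
    have hbp : b ^ p ≤ b ^ ρ₃ := Real.rpow_le_rpow_of_exponent_le hb hp'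
    have hbp0 : 0 ≤ b ^ p := Real.rpow_nonneg hb0 _
    calc c₂ * A * b ^ p ≤ c₂ * A * b ^ ρ₃ := mul_le_mul_of_nonneg_left hbp (mul_nonneg hc₂ hA)
      _ ≤ ρ₄ * A * b ^ ρ₃ := mul_le_mul_of_nonneg_right (mul_le_mul_of_nonneg_right hc₂' hA) (hbp0.trans hbp)
  have hkey : Real.exp (b ^ (3 / 2 : ℝ)) * Real.exp (-((ρ₃ + 1) * b ^ (3 / 2 : ℝ))) = Real.exp (-(ρ₃ * b ^ (3 / 2 : ℝ))) := by
    rw [← Real.exp_add]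
    congr 1
    ring
  calc C * b ^ q * Real.exp (c₂ * A * b ^ p) * Real.exp (-((γ' * b) ^ 2 / 4))
      ≤ C * ((q.factorial : ℝ) * Real.exp (b ^ (3 / 2 : ℝ))) * Real.exp (ρ₄ * A * b ^ ρ₃) *
          (Real.exp (27 / 4 * ρ ^ 4) * Real.exp (-((ρ₃ + 1) * b ^ (3 / 2 : ℝ)))) := by
        gcongr
  _ = (C * q.factorial * Real.exp (27 / 4 * ρ ^ 4)) *
        ((Real.exp (b ^ (3 / 2 : ℝ)) * Real.exp (-((ρ₃ + 1) * b ^ (3 / 2 : ℝ)))) * Real.exp (ρ₄ * A * b ^ ρ₃)) := by ring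
  _ = _ := by rw [hkey]

/-- **SHAPE (iv): Appendix A's terminal loss `k₁e^{−k₂c²}` at the cut-off `c = γ′b`** (`k₁, k₂ > 0`): `k₁·e^{−k₂(γ′b)²} ≤ (k₁·e^{27ρ⁴/4})·e^{−ρ₃b^{3/2}}·e^{ρ₄Ab^{ρ₃}}`
with `ρ := ρ₃/(γ′^{3/2}·(4k₂)^{3/4})` — precisely: `e^{−k₂(γ′b)²} = e^{−(2√k₂·γ′b)²/4}` and the Gaussian tail bound — for `b, A ≥ 0`, `0 < γ′`, `ρ₄ ≥ 0`.
[cite: BenfattoEtAl1978, Appendix A (A.1)–(A.2) p.161, (4.7) p.152] -/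
theorem appendixA_term_le_snd {k₁ k₂ γ' : ℝ} (hk₁ : 0 ≤ k₁) (hk₂ : 0 < k₂) (hγ' : 0 < γ') (hb : 0 ≤ b) (hA : 0 ≤ A) (hρ₄ : 0 ≤ ρ₄) :
    k₁ * Real.exp (-(k₂ * (γ' * b) ^ 2)) ≤
      (k₁ * Real.exp (27 / 4 * (ρ₃ / (2 * Real.sqrt k₂ * γ') ^ (3 / 2 : ℝ)) ^ 4)) *
        (Real.exp (-(ρ₃ * b ^ (3 / 2 : ℝ))) * Real.exp (ρ₄ * A * b ^ ρ₃)) := by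
  set g : ℝ := 2 * Real.sqrt k₂ * γ' with hg
  have hg0 : 0 < g := by positivity
  have hgb : 0 ≤ g * b := mul_nonneg hg0.le hb
  have hsq : k₂ * (γ' * b) ^ 2 = (g * b) ^ 2 / 4 := by
    rw [hg]
    have := Real.sq_sqrt hk₂.le
    nlinarith [this]
  set ρ : ℝ := ρ₃ / g ^ (3 / 2 : ℝ) with hρ
  have hg32 : 0 < g ^ (3 / 2 : ℝ) := Real.rpow_pos_of_pos hg0 _
  have h1 : Real.exp (-((g * b) ^ 2 / 4)) ≤ Real.exp (27 / 4 * ρ ^ 4) * Real.exp (-(ρ * (g * b) ^ (3 / 2 : ℝ))) :=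
    exp_neg_sq_div_four_le_exp_neg_rpow hgb ρ
  have h1' : ρ * (g * b) ^ (3 / 2 : ℝ) = ρ₃ * b ^ (3 / 2 : ℝ) := by
    rw [Real.mul_rpow hg0.le hb, hρ]
    field_simp
  rw [h1'] at h1
  rw [hsq]
  have h2 : (1 : ℝ) ≤ Real.exp (ρ₄ * A * b ^ ρ₃) := Real.one_le_exp (mul_nonneg (mul_nonneg hρ₄ hA) (Real.rpow_nonneg hb _))
  calc k₁ * Real.exp (-((g * b) ^ 2 / 4)) ≤ k₁ * (Real.exp (27 / 4 * ρ ^ 4) * Real.exp (-(ρ₃ * b ^ (3 / 2 : ℝ)))) * 1 := by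
        rw [mul_one]
        exact mul_le_mul_of_nonneg_left h1 hk₁
    _ ≤ k₁ * (Real.exp (27 / 4 * ρ ^ 4) * Real.exp (-(ρ₃ * b ^ (3 / 2 : ℝ)))) * Real.exp (ρ₄ * A * b ^ ρ₃) :=
        mul_le_mul_of_nonneg_left h2 (mul_nonneg hk₁ (mul_nonneg (Real.exp_pos _).le (Real.exp_pos _).le))
    _ = _ := by ring

end Second

/-! ## §3  Shape (i) fits the first summand `(A·b^{ρ₁}·e^{ρ₂Ab^{ρ₃}})^{t+1}` -/

section First

variable {A b ρ₁ ρ₂ ρ₃ : ℝ}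

/-- **SHAPE (i): the `(t+1)`-st order remainder `C·(A·b^{p})^{t+1}`** ((5.21)/(5.33) with `K = 4s₁Ab^{D}L^{d} ≤ 4·2^{d}s₁·A·b^{D+2d}`, `p = D + 2d`):
for `b ≥ 1`, `A, C ≥ 0`, `p ≤ ρ₁`, `ρ₂ ≥ 0`, `C·(A·b^{p})^{t+1} ≤ C·(A·b^{ρ₁}·e^{ρ₂Ab^{ρ₃}})^{t+1}`. [cite: BenfattoEtAl1978, (5.21) p.156, (5.33) p.158, (4.7) p.152] -/
theorem remainder_le_fst {C p : ℝ} (hC : 0 ≤ C) (hA : 0 ≤ A) (hb : 1 ≤ b) (hp : p ≤ ρ₁) (hρ₂ : 0 ≤ ρ₂) (t : ℕ) :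
    C * (A * b ^ p) ^ (t + 1) ≤ C * (A * b ^ ρ₁ * Real.exp (ρ₂ * A * b ^ ρ₃)) ^ (t + 1) := by
  have hb0 : 0 ≤ b := zero_le_one.trans hb
  refine mul_le_mul_of_nonneg_left (pow_le_pow_left₀ (mul_nonneg hA (Real.rpow_nonneg hb0 _)) ?_ _) hC
  have h1 : A * b ^ p ≤ A * b ^ ρ₁ := mul_le_mul_of_nonneg_left (Real.rpow_le_rpow_of_exponent_le hb hp) hA
  have h2 : (1 : ℝ) ≤ Real.exp (ρ₂ * A * b ^ ρ₃) := Real.one_le_exp (mul_nonneg (mul_nonneg hρ₂ hA) (Real.rpow_nonneg hb0 _))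
  calc A * b ^ p ≤ A * b ^ ρ₁ * 1 := by rw [mul_one]; exact h1
    _ ≤ A * b ^ ρ₁ * Real.exp (ρ₂ * A * b ^ ρ₃) := mul_le_mul_of_nonneg_left h2 (mul_nonneg hA (Real.rpow_nonneg hb0 _))

end First

/-! ## §4  Print's parameters: `L = ⌈b²⌉`, `v = ⌈M b^{3/2}⌉`, `w = 2v`, displaced pavements fit, cut-offs `≥ 1` -/

section Parameters

/-- `b² ≤ ⌈b²⌉₊`. [cite: BenfattoEtAl1978, §5 p.154 (tesserae of side `l`), p.159] -/
theorem sq_le_natCeil_sq (b : ℝ) : b ^ 2 ≤ (⌈b ^ 2⌉₊ : ℝ) := Nat.le_ceil _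

/-- `⌈b²⌉₊ ≤ 2b²` for `b ≥ 1`. [cite: BenfattoEtAl1978, §5 p.154, p.159] -/
theorem natCeil_sq_le_two_mul_sq {b : ℝ} (hb : 1 ≤ b) : (⌈b ^ 2⌉₊ : ℝ) ≤ 2 * b ^ 2 := by
  have h1 : (1 : ℝ) ≤ b ^ 2 := by nlinarith
  have h2 := Nat.ceil_lt_add_one (zero_le_one.trans h1)
  linarith

/-- kernel: `⌈x⌉₊ ≤ x + 1` for `x ≥ 0` (a corridor width `⌈M b^{3/2}⌉` exceeds `M b^{3/2}` by at most one lattice step; `M b^{3/2} ≤ ⌈M b^{3/2}⌉₊`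
itself is Mathlib's `Nat.le_ceil`, the `hX`/`hn` of §2). [folklore] -/
private theorem natCeil_le_add_one {x : ℝ} (hx : 0 ≤ x) : (⌈x⌉₊ : ℝ) ≤ x + 1 := (Nat.ceil_lt_add_one hx).le

/-- **THE DISPLACED PAVEMENTS FIT**: with `v = ⌈M b^{3/2}⌉₊`, `w = 2v` and `L = ⌈b²⌉₊`, the separation requirement `(d+1)·2(2w+v) ≤ L` of
`…PavementChain.sep_of_diagonalShifts` (i.e. `10(d+1)v ≤ L`) holds as soon as `b ≥ (10(d+1)(M+1))²` (`M ≥ 0`).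
[cite: BenfattoEtAl1978, §5 p.154 «we can arrange the pavements», p.159 «displaced by b²/2»] -/
theorem shifts_fit {M b : ℝ} {d : ℕ} (hM : 0 ≤ M) (hb : (10 * ((d : ℝ) + 1) * (M + 1)) ^ 2 ≤ b) :
    (d + 1) * (2 * (2 * (2 * ⌈M * b ^ (3 / 2 : ℝ)⌉₊) + ⌈M * b ^ (3 / 2 : ℝ)⌉₊)) ≤ ⌈b ^ 2⌉₊ := by
  set v : ℕ := ⌈M * b ^ (3 / 2 : ℝ)⌉₊ with hv
  have hK1 : (1 : ℝ) ≤ 10 * ((d : ℝ) + 1) * (M + 1) := by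
    have hd : (0 : ℝ) ≤ d := Nat.cast_nonneg d
    nlinarith
  have hb1 : 1 ≤ b := le_trans (by nlinarith) hb
  have hb0 : 0 ≤ b := zero_le_one.trans hb1
  have hB : 0 ≤ b ^ (3 / 2 : ℝ) := Real.rpow_nonneg hb0 _
  -- `√b ≥ 10(d+1)(M+1)`
  have hsqrt : 10 * ((d : ℝ) + 1) * (M + 1) ≤ Real.sqrt b := by
    rw [← Real.sqrt_sq (zero_le_one.trans hK1)]
    exact Real.sqrt_le_sqrt hb
  -- `b² = b^{3/2}·√b`
  have hsplit : b ^ 2 = b ^ (3 / 2 : ℝ) * Real.sqrt b := by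
    rw [Real.sqrt_eq_rpow, ← Real.rpow_add (lt_of_lt_of_le one_pos hb1)]
    norm_num
  -- real form of the claim
  have hvR : (v : ℝ) ≤ M * b ^ (3 / 2 : ℝ) + 1 := natCeil_le_add_one (mul_nonneg hM hB)
  have h1b : (1 : ℝ) ≤ b ^ (3 / 2 : ℝ) := Real.one_le_rpow hb1 (by norm_num)
  have hreal : ((d : ℝ) + 1) * (2 * (2 * (2 * (v : ℝ)) + v)) ≤ b ^ 2 := by
    have h10 : ((d : ℝ) + 1) * (2 * (2 * (2 * (v : ℝ)) + v)) = 10 * ((d : ℝ) + 1) * v := by ring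
    rw [h10, hsplit]
    have hd : (0 : ℝ) ≤ (d : ℝ) + 1 := by positivity
    calc 10 * ((d : ℝ) + 1) * (v : ℝ) ≤ 10 * ((d : ℝ) + 1) * (M * b ^ (3 / 2 : ℝ) + 1) := by gcongr
      _ ≤ 10 * ((d : ℝ) + 1) * (M * b ^ (3 / 2 : ℝ) + b ^ (3 / 2 : ℝ)) := by gcongr
      _ = b ^ (3 / 2 : ℝ) * (10 * ((d : ℝ) + 1) * (M + 1)) := by ring
      _ ≤ b ^ (3 / 2 : ℝ) * Real.sqrt b := mul_le_mul_of_nonneg_left hsqrt hB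
  have hnat : (((d + 1) * (2 * (2 * (2 * v) + v)) : ℕ) : ℝ) ≤ (⌈b ^ 2⌉₊ : ℝ) := by
    push_cast
    exact hreal.trans (sq_le_natCeil_sq b)
  exact_mod_cast hnat

/-- **The cut-offs of the chain stay `≥ 1`**: `1 ≤ γ^k·b` for `0 < γ ≤ 1`, `k ≤ n` and `b ≥ γ^{−n}` (so `b* ≥ γ^{−(d+1)}` covers `b_k = γ^k b`, `k ≤ d + 1`).
[cite: BenfattoEtAl1978, §5 p.159 «b replaced by γb», b* = max{10⁴, γ⁻³b̄}] -/
theorem one_le_pow_mul_of_le {γ b : ℝ} {k n : ℕ} (hγ0 : 0 < γ) (hγ1 : γ ≤ 1) (hk : k ≤ n) (hb : (γ ^ n)⁻¹ ≤ b) : 1 ≤ γ ^ k * b := by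
  have hγn : 0 < γ ^ n := pow_pos hγ0 n
  have hγk : γ ^ n ≤ γ ^ k := pow_le_pow_of_le_one hγ0.le hγ1 hk
  have hb0 : 0 ≤ b := (inv_pos.mpr hγn).le.trans hb
  have h1 : 1 ≤ γ ^ n * b := by
    have := mul_le_mul_of_nonneg_left hb hγn.le
    rwa [mul_inv_cancel₀ hγn.ne'] at this
  calc (1 : ℝ) ≤ γ ^ n * b := h1
    _ ≤ γ ^ k * b := mul_le_mul_of_nonneg_right hγk hb0

end Parameters

/-! ## §5  Uniformity in `s`: the combinatorial constants do not see degrees `p > D` -/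

section Uniform

/-- **No admissible exponents in degree `p > D`**: `nᵢ > 0` for all `i < p` forces `Σnᵢ ≥ p`, so (4.5)'s range `Σnᵢ ≦ D` is empty — the Hamiltonian
(4.5) has at most `D` factors per monomial whatever `s` is. [cite: BenfattoEtAl1978, (4.5) p.152] -/
theorem admissible_eq_empty_of_lt {p D : ℕ} (h : D < p) : admissible p D = ∅ := by
  refine Finset.eq_empty_of_forall_notMem fun n hn => ?_
  obtain ⟨hpos, hsum⟩ := mem_admissible.mp hn
  have hp : p ≤ ∑ i, n i := by
    calc p = ∑ _i : Fin p, 1 := by simp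
      _ ≤ ∑ i, n i := Finset.sum_le_sum fun i _ => hpos i
  omega

/-- **THE CONSTANTS ARE UNIFORM IN `s`** (the Lemma p. 152 quantifies its constants before `s`; print: «constants S, ρ₁, ρ₂, ρ₃, ρ₄ depending only on
t, D, d, ϰ»): every combinatorial constant of the form `Σ_{p=1}^{s} #admissible(p,D)·f(p)` with `f ≥ 0` is bounded by its value at `s = D`.
[cite: BenfattoEtAl1978, Lemma p.152, (4.5) p.152, (5.11) p.155] -/
theorem sum_card_admissible_mul_le (s D : ℕ) (f : ℕ → ℝ) (hf : ∀ p, 0 ≤ f p) :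
    ∑ p ∈ Finset.Icc 1 s, ((admissible p D).card : ℝ) * f p ≤ ∑ p ∈ Finset.Icc 1 D, ((admissible p D).card : ℝ) * f p := by
  have hvan : ∀ p, ¬ p ≤ D → ((admissible p D).card : ℝ) * f p = 0 := fun p hp => by
    rw [admissible_eq_empty_of_lt (not_le.mp hp), Finset.card_empty, Nat.cast_zero, zero_mul]
  calc ∑ p ∈ Finset.Icc 1 s, ((admissible p D).card : ℝ) * f p
      = ∑ p ∈ Finset.Icc 1 s, (if p ≤ D then ((admissible p D).card : ℝ) * f p else 0) :=
        Finset.sum_congr rfl fun p _ => by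
          split_ifs with hp
          · rfl
          · exact hvan p hp
    _ = ∑ p ∈ (Finset.Icc 1 s).filter (fun p => p ≤ D), ((admissible p D).card : ℝ) * f p := (Finset.sum_filter _ _).symm
    _ ≤ ∑ p ∈ Finset.Icc 1 D, ((admissible p D).card : ℝ) * f p := by
        refine Finset.sum_le_sum_of_subset_of_nonneg (fun p hp => ?_) fun p _ _ => mul_nonneg (Nat.cast_nonneg _) (hf p)
        rw [Finset.mem_filter, Finset.mem_Icc] at hp
        exact Finset.mem_Icc.mpr ⟨hp.1.1, hp.2⟩

/-- The decay constant of (5.11) is non-negative (`ϰ ≥ 0`). [cite: BenfattoEtAl1978, (5.11) p.155] -/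
theorem decayConst_nonneg {κ : ℝ} (hκ : 0 ≤ κ) (p d : ℕ) : 0 ≤ decayConst κ p d := by
  unfold decayConst
  refine pow_nonneg (mul_nonneg (div_nonneg (by norm_num) ?_) (Real.exp_pos _).le) d
  have hx : 0 ≤ κ / 4 / p / Real.sqrt d := by positivity
  have : Real.exp (-(κ / 4 / p / Real.sqrt d)) ≤ 1 := Real.exp_le_one_iff.mpr (by linarith)
  linarith

/-- **`s₁` of (5.11) is uniform in `s`**: `s1Const s D d ϰ ≤ s1Const D D d ϰ` for every `s` (`ϰ ≥ 0`). [cite: BenfattoEtAl1978, (5.11) p.155, Lemma p.152] -/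
theorem s1Const_le (s D d : ℕ) {κ : ℝ} (hκ : 0 ≤ κ) : s1Const s D d κ ≤ s1Const D D d κ := by
  unfold s1Const
  exact sum_card_admissible_mul_le s D (fun p => decayConst κ p d ^ (p - 1)) fun p => pow_nonneg (decayConst_nonneg hκ p d) _

/-- `s1Const s D d ϰ ≥ 0` (`ϰ ≥ 0`). [cite: BenfattoEtAl1978, (5.11) p.155] -/
theorem s1Const_nonneg (s D d : ℕ) {κ : ℝ} (hκ : 0 ≤ κ) : 0 ≤ s1Const s D d κ := by
  unfold s1Const
  exact Finset.sum_nonneg fun p _ => mul_nonneg (Nat.cast_nonneg _) (pow_nonneg (decayConst_nonneg hκ p d) _)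

end Uniform

end Literature.MathematicalPhysics.QuantumFieldTheory.Balaban1983to89.B1Eq324BenfattoSect5ErrTermLedger

end
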